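import Mathlib.Algebra.MvPolynomial.NoZeroDivisors
import Literature.Computability.AlgebraicComplexity.StandardFamilies
import HarnessLib

/-!
# The permanent polynomial is irreducible (von zur Gathen 1987, Thm. 3.4)

Topic `Literature/Computability/AlgebraicComplexity`.  Second file of the bottom-up proof of
`lr_left_equivariant_lower` (LR17 Thm. 2.8; plan in `LandsbergRessayreNormalForm.lean`): step (B2)
there needs that a factorisation `det M₁ · det M₂ = c · perm_m` has a constant factor, i.e. that
`perm_m` is irreducible.

* `permMonomial ρ` — the exponent vector of the permutation monomial `∏_i X_{ρ i, i}`;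
  `perPoly n R = ∑_ρ X^{permMonomial ρ}` (`perPoly_eq_sum_monomial`), all with coefficient `1`.
* **Theorem** `perPoly_irreducible` (von zur Gathen 1987, Thm. 3.4: "`per x ∈ F[x]` is absolutely
  irreducible", stated there for fields; here for every integral domain `R` and every non-empty
  finite index type): `Irreducible (perPoly n R)`.

The proof given here is elementary and characteristic-free (vzG deduces the theorem from his
Thm. 3.1 in characteristic `≠ 2` and from the determinant in characteristic `2`): if
`g h = perm`, every variable has degree `1` in `perm`, hence lies in exactly one of `vars g`,
`vars h`; comparing the coefficients of the "hybrid" monomials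
`X^{(μ_π)|vars g} · X^{(μ_π')|vars h}` (which must again be permutation monomials) shows that
`vars g` is a union of full rows and of full columns, hence empty or everything.

## References

* J. von zur Gathen, *Permanent and determinant*, Linear Algebra Appl. 96 (1987) 87–100, Thm. 3.4.
-/

noncomputable section

namespace Literature.Computability.AlgebraicComplexity

open MvPolynomial

/-! ### Row and column counts of exponent vectors -/

section Counts

variable {n : Type*} [Fintype n]

/-- Row count of an exponent vector: the number of variables taken from row `r`. [folklore] -/
def rowCount (d : (n × n) →₀ ℕ) (r : n) : ℕ := ∑ c, d (r, c)

/-- Column count of an exponent vector. [folklore] -/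
def colCount (d : (n × n) →₀ ℕ) (c : n) : ℕ := ∑ r, d (r, c)

/-- `rowCount` is additive. [folklore] -/
theorem rowCount_add (d d' : (n × n) →₀ ℕ) (r : n) :
    rowCount (d + d') r = rowCount d r + rowCount d' r := by
  simp [rowCount, Finset.sum_add_distrib]

/-- `colCount` is additive. [folklore] -/
theorem colCount_add (d d' : (n × n) →₀ ℕ) (c : n) :
    colCount (d + d') c = colCount d c + colCount d' c := by
  simp [colCount, Finset.sum_add_distrib]

end Counts

/-! ### Permutation monomials -/

section PermMonomial

variable {n : Type*} [Fintype n] [DecidableEq n]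

/-- The exponent vector `μ_ρ = ∑_i e_{(ρ i, i)}` of the permutation monomial `∏_i X_{ρ i, i}` of the
permanent/determinant (von zur Gathen 1987, §2; Bürgisser 2000, (2.2)). [cite: Vonzurgathen1987, Thm. 3.4] -/
def permMonomial (ρ : Equiv.Perm n) : (n × n) →₀ ℕ :=
  ∑ i, Finsupp.single (ρ i, i) 1

/-- `μ_ρ (r, c) = [ρ c = r]`. [folklore] -/
theorem permMonomial_apply (ρ : Equiv.Perm n) (r c : n) :
    permMonomial ρ (r, c) = if ρ c = r then 1 else 0 := by
  simp only [permMonomial, Finsupp.coe_finsetSum, Finset.sum_apply, Finsupp.single_apply,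
    Prod.mk.injEq]
  rw [Finset.sum_eq_single c]
  · simp
  · intro i _ hic
    simp [hic]
  · simp

/-- `ρ ↦ μ_ρ` is injective. [folklore] -/
theorem permMonomial_injective : Function.Injective (permMonomial (n := n)) := by
  intro ρ π h
  ext c
  have := DFunLike.congr_fun h (ρ c, c)
  rw [permMonomial_apply, permMonomial_apply, if_pos rfl] at this
  by_contra hne
  rw [if_neg (show ¬π c = ρ c from fun h' => hne h'.symm)] at this
  exact one_ne_zero this

/-- A permutation monomial restricted to a set of cells `P` takes `[P (r, ρ⁻¹ r)]` variables from
row `r`. [folklore] -/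
theorem rowCount_filter_permMonomial (P : n × n → Prop) [DecidablePred P] (ρ : Equiv.Perm n)
    (r : n) : rowCount ((permMonomial ρ).filter P) r = if P (r, ρ.symm r) then 1 else 0 := by
  simp only [rowCount, Finsupp.filter_apply, permMonomial_apply]
  rw [Finset.sum_eq_single (ρ.symm r)]
  · simp
  · intro c _ hc
    have : ρ c ≠ r := fun h => hc (by rw [← h, Equiv.symm_apply_apply])
    simp [this]
  · simp

/-- Likewise for columns: `[P (ρ c, c)]`. [folklore] -/
theorem colCount_filter_permMonomial (P : n × n → Prop) [DecidablePred P] (ρ : Equiv.Perm n)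
    (c : n) : colCount ((permMonomial ρ).filter P) c = if P (ρ c, c) then 1 else 0 := by
  simp only [colCount, Finsupp.filter_apply, permMonomial_apply]
  rw [Finset.sum_eq_single (ρ c)]
  · simp
  · intro r _ hr
    simp [Ne.symm hr]
  · simp

/-- A permutation monomial takes exactly one variable from each row. [folklore] -/
theorem rowCount_permMonomial (ρ : Equiv.Perm n) (r : n) : rowCount (permMonomial ρ) r = 1 := by
  simp only [rowCount, permMonomial_apply]
  rw [Finset.sum_eq_single (ρ.symm r)]
  · simp
  · intro c _ hc
    have : ρ c ≠ r := fun h => hc (by rw [← h, Equiv.symm_apply_apply])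
    simp [this]
  · simp

/-- A permutation monomial takes exactly one variable from each column. [folklore] -/
theorem colCount_permMonomial (ρ : Equiv.Perm n) (c : n) : colCount (permMonomial ρ) c = 1 := by
  simp only [colCount, permMonomial_apply]
  rw [Finset.sum_eq_single (ρ c)]
  · simp
  · intro r _ hr
    simp [Ne.symm hr]
  · simp

variable (R : Type*) [CommSemiring R]

/-- `perm = ∑_ρ X^{μ_ρ}` (Bürgisser 2000, (2.2); von zur Gathen 1987, §2). [cite: Vonzurgathen1987, Thm. 3.4] -/
theorem perPoly_eq_sum_monomial :
    perPoly n R = ∑ ρ : Equiv.Perm n, monomial (permMonomial ρ) (1 : R) := by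
  unfold perPoly Matrix.permanent
  refine Finset.sum_congr rfl fun ρ _ => ?_
  rw [permMonomial, monomial_sum_one]
  refine Finset.prod_congr rfl fun i _ => ?_
  simp [Matrix.mvPolynomialX_apply, X]

/-- The coefficients of the permanent. [folklore] -/
theorem coeff_perPoly (d : (n × n) →₀ ℕ) :
    coeff d (perPoly n R) = ∑ ρ : Equiv.Perm n, if permMonomial ρ = d then (1 : R) else 0 := by
  rw [perPoly_eq_sum_monomial, coeff_sum]
  simp only [coeff_monomial]

/-- Each permutation monomial has coefficient `1` in the permanent. [folklore] -/
theorem coeff_permMonomial_perPoly (ρ : Equiv.Perm n) :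
    coeff (permMonomial ρ) (perPoly n R) = 1 := by
  rw [coeff_perPoly, Finset.sum_eq_single ρ]
  · simp
  · intro π _ hπ
    simp [permMonomial_injective.ne hπ]
  · simp

/-- The support of the permanent consists of permutation monomials. [folklore] -/
theorem exists_permMonomial_eq_of_coeff_perPoly_ne_zero {d : (n × n) →₀ ℕ}
    (h : coeff d (perPoly n R) ≠ 0) : ∃ ρ : Equiv.Perm n, permMonomial ρ = d := by
  by_contra hne
  push Not at hne
  apply h
  rw [coeff_perPoly]
  exact Finset.sum_eq_zero fun ρ _ => if_neg (hne ρ)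

/-- Every variable has degree exactly `1` in the permanent (it is multilinear and every variable
occurs). [folklore] -/
theorem degreeOf_perPoly [Nontrivial R] (v : n × n) : degreeOf v (perPoly n R) = 1 := by
  apply le_antisymm
  · rw [degreeOf_le_iff]
    intro d hd
    obtain ⟨ρ, rfl⟩ := exists_permMonomial_eq_of_coeff_perPoly_ne_zero R (mem_support_iff.1 hd)
    obtain ⟨r, c⟩ := v
    rw [permMonomial_apply]
    split_ifs <;> simp
  · obtain ⟨r, c⟩ := v
    have hmem : permMonomial (Equiv.swap c r) ∈ (perPoly n R).support := by
      rw [mem_support_iff, coeff_permMonomial_perPoly]; exact one_ne_zero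
    have := monomial_le_degreeOf (r, c) hmem
    rwa [permMonomial_apply, Equiv.swap_apply_left, if_pos rfl] at this

end PermMonomial

/-! ### Products of polynomials in separated sets of variables -/

section Separated

variable {σ : Type*} {R : Type*} [CommSemiring R]

/-- If the monomials of `g` only involve variables in `S` and those of `h` only variables outside
`S`, then the coefficient of `X^ν` in `g h` is `g_{ν|S} · h_{ν|Sᶜ}`. [folklore] -/
theorem coeff_mul_of_separated [DecidableEq σ] (S : Finset σ) {g h : MvPolynomial σ R}
    (hg : ∀ d ∈ g.support, ∀ v, d v ≠ 0 → v ∈ S) (hh : ∀ d ∈ h.support, ∀ v, d v ≠ 0 → v ∉ S)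
    (ν : σ →₀ ℕ) :
    coeff ν (g * h) = coeff (ν.filter (· ∈ S)) g * coeff (ν.filter (¬ · ∈ S)) h := by
  rw [coeff_mul]
  have key : ∀ x ∈ Finset.antidiagonal ν, coeff x.1 g * coeff x.2 h ≠ 0 →
      x = (ν.filter (· ∈ S), ν.filter (¬ · ∈ S)) := by
    intro x hx hne
    have h1 : coeff x.1 g ≠ 0 := left_ne_zero_of_mul hne
    have h2 : coeff x.2 h ≠ 0 := right_ne_zero_of_mul hne
    rw [Finset.mem_antidiagonal] at hx
    have hv : ∀ v, x.1 v + x.2 v = ν v := fun v => by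
      have := DFunLike.congr_fun hx v
      simpa using this
    have hz1 : ∀ v, v ∉ S → x.1 v = 0 := fun v hvS => by
      by_contra h0; exact hvS (hg x.1 (mem_support_iff.2 h1) v h0)
    have hz2 : ∀ v, v ∈ S → x.2 v = 0 := fun v hvS => by
      by_contra h0; exact hh x.2 (mem_support_iff.2 h2) v h0 hvS
    refine Prod.ext ?_ ?_
    · ext v
      rw [Finsupp.filter_apply]
      by_cases hvS : v ∈ S
      · have := hv v; rw [hz2 v hvS] at this; simp [hvS, ← this]
      · simp [hvS, hz1 v hvS]
    · ext v
      rw [Finsupp.filter_apply]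
      by_cases hvS : v ∈ S
      · simp [hvS, hz2 v hvS]
      · have := hv v; rw [hz1 v hvS] at this; simp [hvS, ← this]
  rw [Finset.sum_eq_single (ν.filter (· ∈ S), ν.filter (¬ · ∈ S))]
  · intro x hx hne
    by_contra h0
    exact hne (key x hx h0)
  · intro hnot
    exfalso; apply hnot
    rw [Finset.mem_antidiagonal]
    exact Finsupp.filter_add_filter_not ν _

/-- A polynomial all of whose monomials are trivial is a constant. [folklore] -/
theorem eq_C_of_support_subset_zero {p : MvPolynomial σ R} (hp : ∀ d ∈ p.support, d = 0) :
    p = C (coeff 0 p) := by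
  rw [← totalDegree_eq_zero_iff_eq_C]
  apply Nat.eq_zero_of_le_zero
  rw [totalDegree]
  refine Finset.sup_le fun d hd => ?_
  rw [hp d hd]
  simp

end Separated

/-! ### Irreducibility -/

section Irreducible

variable {n : Type*} [Fintype n] [DecidableEq n] {R : Type*} [CommRing R] [IsDomain R]

/-- Key step: if `g h = perm`, then the set `S` of variables occurring in `g` is empty or
everything. [cite: Vonzurgathen1987, Thm. 3.4] -/
theorem vars_factor_perPoly_trivial {g h : MvPolynomial (n × n) R} (hgh : g * h = perPoly n R) :
    (∀ d ∈ g.support, d = 0) ∨ (∀ d ∈ h.support, d = 0) := by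
  classical
  have hne : g * h ≠ 0 := by
    rw [hgh]; intro h0
    have := coeff_permMonomial_perPoly R (1 : Equiv.Perm n)
    rw [h0, coeff_zero] at this
    exact zero_ne_one this
  have hg0 : g ≠ 0 := left_ne_zero_of_mul hne
  have hh0 : h ≠ 0 := right_ne_zero_of_mul hne
  -- the variables split between `g` and `h`
  have hdeg : ∀ v, degreeOf v g + degreeOf v h = 1 := fun v => by
    rw [← degreeOf_mul_eq hg0 hh0, hgh, degreeOf_perPoly]
  set S : Finset (n × n) := Finset.univ.filter fun v => degreeOf v g ≠ 0 with hS
  have hgS : ∀ d ∈ g.support, ∀ v, d v ≠ 0 → v ∈ S := fun d hd v hv => by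
    rw [hS, Finset.mem_filter]
    refine ⟨Finset.mem_univ _, fun h0 => hv ?_⟩
    have := monomial_le_degreeOf v hd
    omega
  have hhS : ∀ d ∈ h.support, ∀ v, d v ≠ 0 → v ∉ S := fun d hd v hv hvS => by
    rw [hS, Finset.mem_filter] at hvS
    have h1 := monomial_le_degreeOf v hd
    have h2 := hdeg v
    omega
  -- (F1) every permutation monomial splits into a `g`-part and an `h`-part with non-zero coefficients
  have F1 : ∀ π : Equiv.Perm n,
      coeff ((permMonomial π).filter (· ∈ S)) g * coeff ((permMonomial π).filter (¬ · ∈ S)) h = 1 :=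
    fun π => by rw [← coeff_mul_of_separated S hgS hhS, hgh, coeff_permMonomial_perPoly]
  -- (F2) hybrid monomials are permutation monomials
  have F2 : ∀ π π' : Equiv.Perm n, ∃ ρ : Equiv.Perm n, permMonomial ρ =
      (permMonomial π).filter (· ∈ S) + (permMonomial π').filter (¬ · ∈ S) := by
    intro π π'
    set ν := (permMonomial π).filter (· ∈ S) + (permMonomial π').filter (¬ · ∈ S) with hν
    have e1 : ν.filter (· ∈ S) = (permMonomial π).filter (· ∈ S) := by
      ext v; simp only [hν, Finsupp.filter_apply, Finsupp.add_apply]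
      by_cases hv : v ∈ S <;> simp [hv]
    have e2 : ν.filter (¬ · ∈ S) = (permMonomial π').filter (¬ · ∈ S) := by
      ext v; simp only [hν, Finsupp.filter_apply, Finsupp.add_apply]
      by_cases hv : v ∈ S <;> simp [hv]
    have hcoeff : coeff ν (g * h) ≠ 0 := by
      rw [coeff_mul_of_separated S hgS hhS, e1, e2]
      have a := F1 π
      have b := F1 π'
      exact mul_ne_zero (left_ne_zero_of_mul (a.symm ▸ one_ne_zero))
        (right_ne_zero_of_mul (b.symm ▸ one_ne_zero))
    rw [hgh] at hcoeff
    exact exists_permMonomial_eq_of_coeff_perPoly_ne_zero R hcoeff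
  -- (F3) rows: `S` is a union of full rows
  have F3 : ∀ r b b', (r, b) ∈ S → (r, b') ∈ S := by
    intro r b b' hrb
    obtain ⟨ρ, hρ⟩ := F2 (Equiv.swap b r) (Equiv.swap b' r)
    have := rowCount_permMonomial ρ r
    rw [hρ, rowCount_add, rowCount_filter_permMonomial, rowCount_filter_permMonomial,
      Equiv.symm_swap, Equiv.symm_swap, Equiv.swap_apply_right, Equiv.swap_apply_right,
      if_pos hrb] at this
    by_contra hb'
    rw [if_pos hb'] at this
    omega
  -- (F4) columns: `S` is a union of full columns
  have F4 : ∀ c a a', (a, c) ∈ S → (a', c) ∈ S := by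
    intro c a a' hac
    obtain ⟨ρ, hρ⟩ := F2 (Equiv.swap c a) (Equiv.swap c a')
    have := colCount_permMonomial ρ c
    rw [hρ, colCount_add, colCount_filter_permMonomial, colCount_filter_permMonomial,
      Equiv.swap_apply_left, Equiv.swap_apply_left, if_pos hac] at this
    by_contra ha'
    rw [if_pos ha'] at this
    omega
  -- hence `S = ∅` or `S = univ`
  by_cases hSne : S.Nonempty
  · -- `S = univ`: `h` has no variables
    right
    obtain ⟨⟨a, b⟩, hab⟩ := hSne
    have hall : ∀ v : n × n, v ∈ S := fun ⟨i, j⟩ => F4 j a i (F3 a b j hab)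
    intro d hd
    ext v
    by_contra hv
    exact hhS d hd v hv (hall v)
  · -- `S = ∅`: `g` has no variables
    left
    intro d hd
    ext v
    by_contra hv
    exact hSne ⟨v, hgS d hd v hv⟩

/-- **The permanent is irreducible** (von zur Gathen 1987, Thm. 3.4: `per x ∈ F[x]` is absolutely
irreducible, any field `F`, `n ≥ 1`); here over any integral domain and any non-empty finite index
type. [cite: Vonzurgathen1987, Thm. 3.4] -/
theorem perPoly_irreducible [Nonempty n] : Irreducible (perPoly n R) := by
  classical
  refine ⟨fun hu => ?_, fun g h hgh => ?_⟩
  · -- not a unit: a unit has degree `0` in every variable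
    obtain ⟨u, hu⟩ := hu
    obtain ⟨i⟩ := ‹Nonempty n›
    have h1 : degreeOf (i, i) (perPoly n R) = 1 := degreeOf_perPoly R (i, i)
    have hprod : (u : MvPolynomial (n × n) R) * (↑u⁻¹ : MvPolynomial (n × n) R) = 1 := by
      rw [← Units.val_mul, mul_inv_cancel, Units.val_one]
    have hu0 : (u : MvPolynomial (n × n) R) ≠ 0 := by
      rw [hu]; intro h0; rw [h0, degreeOf_zero] at h1; exact zero_ne_one h1
    have hui0 : (↑u⁻¹ : MvPolynomial (n × n) R) ≠ 0 := fun h0 => by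
      rw [h0, mul_zero] at hprod; exact zero_ne_one hprod
    have := degreeOf_mul_eq (n := (i, i)) hu0 hui0
    rw [hprod, degreeOf_one, hu, h1] at this
    omega
  · rcases vars_factor_perPoly_trivial hgh.symm with hg | hh
    · left
      have hgC := eq_C_of_support_subset_zero hg
      have key : coeff 0 g * coeff (permMonomial 1) h = 1 := by
        have := congrArg (coeff (permMonomial (1 : Equiv.Perm n))) hgh
        rw [coeff_permMonomial_perPoly, hgC, coeff_C_mul] at this
        exact this.symm
      rw [hgC]
      exact (IsUnit.of_mul_eq_one _ key).map C
    · right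
      have hhC := eq_C_of_support_subset_zero hh
      have key : coeff (permMonomial 1) g * coeff 0 h = 1 := by
        have := congrArg (coeff (permMonomial (1 : Equiv.Perm n))) hgh
        rw [coeff_permMonomial_perPoly, hhC, mul_comm, coeff_C_mul] at this
        rw [mul_comm]; exact this.symm
      rw [hhC]
      exact (IsUnit.of_mul_eq_one_right _ key).map C

/-- Hence, over a field, a factorisation `g h = c · perm` with `c ≠ 0` has a unit factor (the form
used in step (B2) of the proof of LR17 Thm. 2.8). [cite: Vonzurgathen1987, Thm. 3.4] -/
theorem isUnit_or_isUnit_of_mul_eq_C_mul_perPoly {k : Type*} [Field k] [Nonempty n]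
    {g h : MvPolynomial (n × n) k} {c : k} (hc : c ≠ 0) (hgh : g * h = C c * perPoly n k) :
    IsUnit g ∨ IsUnit h := by
  have hirr : Irreducible (C c * perPoly n k) :=
    (irreducible_isUnit_mul ((IsUnit.mk0 c hc).map C)).2 perPoly_irreducible
  exact hirr.isUnit_or_isUnit hgh.symm

end Irreducible

end Literature.Computability.AlgebraicComplexity
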